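import Summits.CriticalPhenomena.CardyFormulaZ2.Theorems.CardySusyWardParafermionFamiliesToSLESixTotalSmallLayer

/-!
# The vanishing side of the boundary first-moment identity (stub `stub_totalSmall_of_UIE` of the line
# `strip-anchored-vertex-normalisation`, skeleton r4, crux stmt-CriticalPhenomena-10814), II: the theorem

`stub_totalSmall_of_UIE` (registered signature): `UniformInnerEnvelope → ∀ Λ, IsFamily anchorDomain Λ →
VertexVanishes anchorDomain Λ → ∀ η > 0, ∀ᶠ δ in 𝓝[>] 0, ‖totalVertexSum (Λ δ) δ‖ ≤ η δ^{-5/3}` — under the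
uniform inner envelope, vertex vanishing on compacts (the typed second hypothesis `ParafermionPrecompact` of the
crux, `parafermionPrecompact_iff_vanishing`) along a discretisation family of the anchor square makes the total
vertex observable over the random both-faces-inner medial vertices `o(δ^{-5/3})`, the other side of the line's
moment identity (`stub_momentIdentity`, `stub_anchorMoment_of_IP`: the boundary first moment is `≍ δ^{-5/3}`).

Proof. ONE SCALE (`TotalSmall.norm_totalVertexSum_le`): for admissible data `E` on the anchor at mesh
`δ ≤ min(h,1)` with the inputs of helper file I, the `finsum` is a finite sum over the `≤ 2(2L+1)² ≤ 50/δ²` random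
vertices of the lattice diamond (a random vertex is an edge of `Ω_δ`); the FAR vertices (medial point at distance
`≥ h` from `Ωᶜ`) carry `ε δ^{1/3}` each; a NEAR vertex has depth `dep ≤ M = ⌊2h/δ⌋ + 1` (its site is within `δ/2`
of the medial point) and carries `8C(dep+1)^{-1/3}`, each depth layer has `≤ 8(2L+1) ≤ 40/δ` vertices, and the
harmonic sum `Σ_{n ≤ M} (n+1)^{-1/3} ≤ (3/2)(M+1)^{2/3}` (`S6.sum_rpow_neg_third_le`) with `M + 1 ≤ 4h/δ` gives
`‖totalVertexSum E δ‖ ≤ 480 C (4h/δ)^{2/3}/δ + 50 ε δ^{1/3}/δ² = (480 C (4h)^{2/3} + 50 ε) δ^{-5/3}`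
(`TotalSmall.scale_identity`). ASSEMBLY: given `η`, the collar width `h ∈ (0,1)` with `(4h)^{2/3} ≤ η/(960 C)`
(`C = max C₀ 1`), the compact `K_h = {z | h ≤ dist(z, Ωᶜ)} ⊆ Ω` (closed, inside the bounded carrier) and
`ε = η/100`; eventually in `δ` (`S5.anchor_geometry`, vanishing on `K_h`, `δ < h`). [folklore]
-/

noncomputable section

namespace Summit.CriticalPhenomena.CardyFormulaZ2.Theorems.ParafermionFamiliesToSLESix.StripAnchored

open MeasureTheory Filter Set Metric Complex
open scoped Topology BigOperators
open Literature.Probability.LatticeModels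
open Literature.Probability.RandomPlanarGeometry (DobrushinDomain)
open Literature.Barriers.CriticalPhenomena (medialCornersAt medialVertexOf isCorner_medialCornersAt)
open Summit.CriticalPhenomena.CardyFormulaZ2.Theorems.ParafermionPrecompact.Negative (IsFamily VanishesOn)
open Summit.CriticalPhenomena.CardyFormulaZ2.Cruxes.EdgePrecompact.QkzStripBoundaryArm (cornerObs UniformInnerEnvelope
  norm_cornerObs_le_one)
open S5 (anchorDomain mem_anchorDomain_carrier anchor_level_nonneg)

namespace TotalSmall

variable {E : DiscreteDobrushin} {δ : ℝ} {L : ℤ} {C : ℝ}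

/-! ## The estimate at one scale -/

/-- The final arithmetic of the scale: `480C(4h/δ)^{2/3}/δ + 50 ε δ^{1/3}/δ² = (480C(4h)^{2/3} + 50ε) δ^{-5/3}`.
[folklore] -/
theorem scale_identity {δ C h ε : ℝ} (hδ : 0 < δ) (hh : 0 ≤ h) :
    480 * C * (4 * h / δ) ^ ((2:ℝ) / 3) / δ + 50 / δ ^ 2 * (ε * δ ^ ((1:ℝ) / 3)) =
      (480 * C * (4 * h) ^ ((2:ℝ) / 3) + 50 * ε) * δ ^ (-(5:ℝ) / 3) := by
  set P := δ ^ ((1:ℝ) / 3) with hP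
  have hP0 : 0 < P := Real.rpow_pos_of_pos hδ _
  have hP3 : δ = P ^ 3 := by
    rw [hP, ← Real.rpow_natCast, ← Real.rpow_mul hδ.le]; norm_num
  have hQ : δ ^ ((2:ℝ) / 3) = P ^ 2 := by
    rw [hP, ← Real.rpow_natCast, ← Real.rpow_mul hδ.le]; norm_num
  have h53 : δ ^ (-(5:ℝ) / 3) = (P ^ 5)⁻¹ := by
    rw [hP, ← Real.rpow_natCast, ← Real.rpow_mul hδ.le, ← Real.rpow_neg hδ.le]; norm_num
  rw [Real.div_rpow (by positivity) hδ.le, hQ, h53, hP3]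
  field_simp

/-- **The total vertex sum at one scale.** Admissible data `E` on the anchor square at mesh `δ ≤ min(h, 1)`,
lattice diamond of size `L` (`L δ < 2 ≤ (L+1) δ`), envelope constant `C ≥ 1` at every corner of lattice depth
`R ≥ 1`, and `‖vertexObs‖ ≤ ε δ^{1/3}` at the medial vertices at distance `≥ h` from `Ωᶜ`. Then
`‖totalVertexSum E δ‖ ≤ 480 C (4h/δ)^{2/3}/δ + 50 ε δ^{1/3}/δ²`: the `finsum` is a finite sum over the
`≤ 2(2L+1)² ≤ 50/δ²` random vertices of the diamond; the FAR ones (distance `≥ h`) carry `ε δ^{1/3}` each;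
a NEAR one has depth `dep ≤ M = ⌊2h/δ⌋ + 1` and carries `8C(dep+1)^{-1/3}` (`norm_vertexObs_le_profile`), each
depth layer has `≤ 8(2L+1) ≤ 40/δ` vertices (`card_fiber_le`), and `Σ_{n ≤ M} (n+1)^{-1/3} ≤ (3/2)(M+1)^{2/3}`
(`S6.sum_rpow_neg_third_le`) with `M + 1 ≤ 4h/δ`. [folklore] -/
theorem norm_totalVertexSum_le (hE : E.IsZdAdmissible) (hEδ : E.δ = δ) (hLδ : (L : ℝ) * δ < 2)
    (hL1 : 2 ≤ ((L : ℝ) + 1) * δ) (hmesh : ∀ v : Site 2, v ∈ meshDomain E.Ω δ ↔ |v 0 + v 1| ≤ L ∧ |v 0 - v 1| ≤ L)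
    {h ε : ℝ} (hδh : δ ≤ h) (hδ1 : δ ≤ 1) (hC : 1 ≤ C) (hε : 0 ≤ ε)
    (hUIE : ∀ (v f : Site 2), IsCorner v f → ∀ R : ℕ, 1 ≤ R →
      (R : ℝ) * δ ≤ infDist (meshPoint δ v) anchorDomain.carrierᶜ → ‖cornerObs E δ v f‖ ≤ C * (R : ℝ) ^ (-(1:ℝ) / 3))
    (hVan : ∀ p : Site 2 × Fin 2, h ≤ infDist (medialPoint δ (medialVertexOf p)) anchorDomain.carrierᶜ →
      ‖vertexObs E δ (medialVertexOf p)‖ ≤ ε * δ ^ ((1:ℝ) / 3)) :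
    ‖totalVertexSum E δ‖ ≤ 480 * C * (4 * h / δ) ^ ((2:ℝ) / 3) / δ + 50 / δ ^ 2 * (ε * δ ^ ((1:ℝ) / 3)) := by
  classical
  have hδ : 0 < δ := hEδ ▸ hE.delta_pos
  have hh : 0 < h := lt_of_lt_of_le hδ hδh
  have hL0 : 0 ≤ L := anchor_level_nonneg hδ hL1
  have hL0' : (0:ℝ) ≤ L := by exact_mod_cast hL0
  have h2L : 2 * (L : ℝ) + 1 ≤ 5 / δ := by
    rw [le_div_iff₀ hδ]; nlinarith
  -- the finite set of random vertices; `finsum` → finite sum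
  set RS := (finite_random hE).toFinset with hRSdef
  have hRS : ∀ p, p ∈ RS ↔ IsRandomMV E p := fun p => Set.Finite.mem_toFinset _
  have hdia : ∀ p ∈ RS, |p.1 0 + p.1 1| ≤ L ∧ |p.1 0 - p.1 1| ≤ L := fun p hp =>
    (hmesh p.1).1 (hEδ ▸ (mem_meshDomain_of_random ((hRS p).1 hp)).1)
  have htot : ‖totalVertexSum E δ‖ ≤ ∑ p ∈ RS, ‖vertexObs E δ (medialVertexOf p)‖ := by
    unfold totalVertexSum
    rw [finsum_eq_sum_of_support_subset (s := RS)]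
    · refine (norm_sum_le _ _).trans (Finset.sum_le_sum fun p hp => ?_)
      rw [if_pos ((hRS p).1 hp)]
    · intro p hp
      rw [Function.mem_support] at hp
      by_cases hc : IsRandomMV E p
      · exact Finset.mem_coe.2 ((hRS p).2 hc)
      · exact absurd (if_neg hc) hp
  -- far / near
  set far : Site 2 × Fin 2 → Prop := fun p => h ≤ infDist (medialPoint δ (medialVertexOf p)) anchorDomain.carrierᶜ
    with hfardef
  rw [← Finset.sum_filter_add_sum_filter_not RS far] at htot
  -- FAR: `ε δ^{1/3}` each, at most `2(2L+1)² ≤ 50/δ²` of them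
  have hfar : ∑ p ∈ RS.filter far, ‖vertexObs E δ (medialVertexOf p)‖ ≤ 50 / δ ^ 2 * (ε * δ ^ ((1:ℝ) / 3)) := by
    have hcnt : ((RS.filter far).card : ℝ) ≤ 50 / δ ^ 2 := by
      refine ((Nat.cast_le.2 (Finset.card_filter_le _ _)).trans (card_le_sq hL0 hdia)).trans ?_
      have h1 : (2 * (L : ℝ) + 1) ^ 2 ≤ (5 / δ) ^ 2 := pow_le_pow_left₀ (by positivity) h2L 2
      rw [div_pow] at h1
      have h2 : 2 * (25 / δ ^ 2) = 50 / δ ^ 2 := by ring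
      nlinarith
    have hε' : 0 ≤ ε * δ ^ ((1:ℝ) / 3) := by positivity
    calc ∑ p ∈ RS.filter far, ‖vertexObs E δ (medialVertexOf p)‖
        ≤ ∑ p ∈ RS.filter far, ε * δ ^ ((1:ℝ) / 3) := Finset.sum_le_sum fun p hp => hVan p (Finset.mem_filter.1 hp).2
      _ = ((RS.filter far).card : ℝ) * (ε * δ ^ ((1:ℝ) / 3)) := by rw [Finset.sum_const, nsmul_eq_mul]
      _ ≤ 50 / δ ^ 2 * (ε * δ ^ ((1:ℝ) / 3)) := mul_le_mul_of_nonneg_right hcnt hε'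
  -- NEAR: depth `≤ M`, profile `8C(dep+1)^{-1/3}`, `8(2L+1)` per layer, harmonic sum
  set M : ℕ := ⌊2 * h / δ⌋₊ + 1 with hM
  have hM1 : ((M + 1 : ℕ) : ℝ) ≤ 4 * h / δ := by
    rw [hM]; push_cast
    have h1 := Nat.floor_le (by positivity : (0:ℝ) ≤ 2 * h / δ)
    have h2 : (2:ℝ) ≤ 2 * h / δ := by rw [le_div_iff₀ hδ]; linarith
    have h3 : 2 * h / δ + 2 * h / δ = 4 * h / δ := by ring
    linarith
  have hnear_dep : ∀ p ∈ RS.filter (fun p => ¬ far p),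
      (L - max |p.1 0 + p.1 1| |p.1 0 - p.1 1|).toNat ∈ Finset.range (M + 1) := by
    intro p hp
    obtain ⟨hpR, hpf⟩ := Finset.mem_filter.1 hp
    set n : ℕ := (L - max |p.1 0 + p.1 1| |p.1 0 - p.1 1|).toNat with hn
    have hpf' : infDist (medialPoint δ (medialVertexOf p)) anchorDomain.carrierᶜ < h := not_le.1 hpf
    have h1 := le_infDist_meshPoint hδ hLδ p.1
    have h2 := Metric.infDist_le_infDist_add_dist (x := meshPoint δ p.1) (y := medialPoint δ (medialVertexOf p))
      (s := anchorDomain.carrierᶜ)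
    have h3 : dist (meshPoint δ p.1) (medialPoint δ (medialVertexOf p)) ≤ δ / 2 := by
      rw [dist_eq_norm]; exact S6.norm_meshPoint_fst_sub_medialPoint hδ.le p
    have hcast : ((n : ℕ) : ℝ) = (L : ℝ) - (max |p.1 0 + p.1 1| |p.1 0 - p.1 1| : ℤ) := by
      have := cast_dep (hdia p hpR); rw [← hn] at this; exact_mod_cast this
    rw [← hcast] at h1
    have h4 : ((n : ℕ) : ℝ) * δ < 2 * h + δ := by nlinarith
    have h5 : ((n : ℕ) : ℝ) < 2 * h / δ + 1 := by
      rw [div_add_one hδ.ne', lt_div_iff₀ hδ]; linarith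
    have h6 := Nat.lt_floor_add_one (2 * h / δ)
    rw [Finset.mem_range]
    have : ((n : ℕ) : ℝ) < ((M + 1 : ℕ) : ℝ) := by rw [hM]; push_cast; linarith
    exact_mod_cast this
  have hdia' : ∀ p ∈ RS.filter (fun p => ¬ far p), |p.1 0 + p.1 1| ≤ L ∧ |p.1 0 - p.1 1| ≤ L :=
    fun p hp => hdia p (Finset.mem_filter.1 hp).1
  have hnear : ∑ p ∈ RS.filter (fun p => ¬ far p), ‖vertexObs E δ (medialVertexOf p)‖ ≤
      480 * C * (4 * h / δ) ^ ((2:ℝ) / 3) / δ := by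
    calc ∑ p ∈ RS.filter (fun p => ¬ far p), ‖vertexObs E δ (medialVertexOf p)‖
        ≤ ∑ p ∈ RS.filter (fun p => ¬ far p),
            8 * C * (((L - max |p.1 0 + p.1 1| |p.1 0 - p.1 1|).toNat + 1 : ℕ) : ℝ) ^ (-(1:ℝ) / 3) :=
          Finset.sum_le_sum fun p hp =>
            norm_vertexObs_le_profile hE hδ hLδ hC hUIE ((hRS p).1 (Finset.mem_filter.1 hp).1) (hdia' p hp)
      _ = ∑ n ∈ Finset.range (M + 1), ∑ p ∈ (RS.filter (fun p => ¬ far p)).filter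
            (fun p => (L - max |p.1 0 + p.1 1| |p.1 0 - p.1 1|).toNat = n),
            8 * C * (((L - max |p.1 0 + p.1 1| |p.1 0 - p.1 1|).toNat + 1 : ℕ) : ℝ) ^ (-(1:ℝ) / 3) :=
          (Finset.sum_fiberwise_of_maps_to hnear_dep _).symm
      _ ≤ ∑ n ∈ Finset.range (M + 1), 8 * (2 * (L : ℝ) + 1) * (8 * C * ((n + 1 : ℕ) : ℝ) ^ (-(1:ℝ) / 3)) := by
          refine Finset.sum_le_sum fun n _ => ?_
          rw [Finset.sum_congr rfl fun p hp => by rw [(Finset.mem_filter.1 hp).2], Finset.sum_const, nsmul_eq_mul]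
          exact mul_le_mul_of_nonneg_right (card_fiber_le hL0 hdia' n) (by positivity)
      _ = 64 * C * (2 * (L : ℝ) + 1) * ∑ n ∈ Finset.range (M + 1), ((n + 1 : ℕ) : ℝ) ^ (-(1:ℝ) / 3) := by
          rw [Finset.mul_sum]; exact Finset.sum_congr rfl fun n _ => by ring
      _ ≤ 64 * C * (2 * (L : ℝ) + 1) * (3 / 2 * ((M + 1 : ℕ) : ℝ) ^ ((2:ℝ) / 3)) := by
          gcongr
          exact S6.sum_rpow_neg_third_le (M + 1)
      _ ≤ 64 * C * (5 / δ) * (3 / 2 * (4 * h / δ) ^ ((2:ℝ) / 3)) := by gcongr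
      _ = 480 * C * (4 * h / δ) ^ ((2:ℝ) / 3) / δ := by field_simp; ring
  linarith

end TotalSmall

open TotalSmall in
/-- **Registered stub `stub_totalSmall_of_UIE` (line `strip-anchored-vertex-normalisation` r4, the VANISHING
SIDE of the boundary first-moment identity).** Under the uniform inner envelope, vertex vanishing on compacts along
a discretisation family of the anchor square makes the total vertex observable over the random both-faces-inner
medial vertices `o(δ^{-5/3})`. Given `η`: choose the collar width `h ∈ (0,1)` with `(4h)^{2/3} ≤ η/(960 C)`
(`C = max C₀ 1`, `C₀` the envelope constant), the compact `K_h = {z | h ≤ dist(z, Ωᶜ)} ⊆ Ω` and `ε = η/100`;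
eventually in `δ` (`S5.anchor_geometry`, vanishing on `K_h`, `δ < h`) the one-scale estimate
`norm_totalVertexSum_le` gives `‖totalVertexSum‖ ≤ (480 C (4h)^{2/3} + 50 ε) δ^{-5/3} ≤ η δ^{-5/3}`. [folklore] -/
theorem stub_totalSmall_of_UIE : UniformInnerEnvelope → ∀ Λ : ℝ → DiscreteDobrushin, IsFamily anchorDomain Λ → VertexVanishes anchorDomain Λ → ∀ η > (0:ℝ), ∀ᶠ δ in 𝓝[>] (0:ℝ), ‖totalVertexSum (Λ δ) δ‖ ≤ η * δ ^ (-(5:ℝ) / 3) := by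
  intro hUIE Λ hΛ hV η hη
  obtain ⟨C₀, hC₀⟩ := hUIE
  obtain ⟨C, hCdef⟩ : ∃ C : ℝ, C = max C₀ 1 := ⟨_, rfl⟩
  have hC : 1 ≤ C := hCdef ▸ le_max_right _ _
  have hCC₀ : C₀ ≤ C := hCdef ▸ le_max_left _ _
  have hpow : Filter.Tendsto (fun x : ℝ => (4 * x) ^ ((2:ℝ) / 3)) (𝓝[>] (0:ℝ)) (𝓝 0) := by
    have hc : Continuous (fun x : ℝ => (4 * x) ^ ((2:ℝ) / 3)) :=
      (continuous_const.mul continuous_id).rpow_const fun x => Or.inr (by norm_num)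
    simpa [Real.zero_rpow (by norm_num : ((2:ℝ) / 3) ≠ 0)] using tendsto_nhdsWithin_of_tendsto_nhds (hc.tendsto 0)
  -- the collar width `h`, the compact `K`, the smallness `ε`
  obtain ⟨h, hh1, hh0, hh2⟩ := ((hpow.eventually_le_const (by positivity : (0:ℝ) < η / (960 * C))).and
    (Ioo_mem_nhdsGT (zero_lt_one' ℝ))).exists
  set K : Set ℂ := {z | h ≤ infDist z anchorDomain.carrierᶜ} with hKdef
  have hKD : K ⊆ anchorDomain.carrier := by
    intro z hz
    by_contra hzD
    have h0 : infDist z anchorDomain.carrierᶜ = 0 := Metric.infDist_zero_of_mem hzD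
    have : h ≤ infDist z anchorDomain.carrierᶜ := hz
    linarith
  have hK : IsCompact K :=
    Metric.isCompact_of_isClosed_isBounded (isClosed_le continuous_const (Metric.continuous_infDist_pt _))
      (anchorDomain.isBounded.subset hKD)
  have hε : (0:ℝ) < η / 100 := by positivity
  filter_upwards [S5.anchor_geometry hΛ, hV K hK hKD (η / 100) hε, Ioo_mem_nhdsGT hh0] with δ hgeom hVan hδI
  obtain ⟨hδ0, hδh⟩ := hδI
  obtain ⟨L, -, hLδ, hL1, hE, hEδ, hΩ, hmesh, -⟩ := hgeom
  have hUIE' : ∀ (v f : Site 2), IsCorner v f → ∀ R : ℕ, 1 ≤ R →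
      (R : ℝ) * δ ≤ infDist (meshPoint δ v) anchorDomain.carrierᶜ → ‖cornerObs (Λ δ) δ v f‖ ≤ C * (R : ℝ) ^ (-(1:ℝ) / 3) := by
    intro v f hvf R hR hRd
    have h1 := hC₀ anchorDomain (Λ δ) hΩ hE v f hvf R hR (by rw [hEδ]; exact hRd)
    rw [hEδ] at h1
    exact h1.trans (mul_le_mul_of_nonneg_right hCC₀ (Real.rpow_nonneg (Nat.cast_nonneg R) _))
  have hVan' : ∀ p : Site 2 × Fin 2, h ≤ infDist (medialPoint δ (medialVertexOf p)) anchorDomain.carrierᶜ →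
      ‖vertexObs (Λ δ) δ (medialVertexOf p)‖ ≤ η / 100 * δ ^ ((1:ℝ) / 3) := fun p hp => hVan (medialVertexOf p) hp
  have main := norm_totalVertexSum_le hE hEδ hLδ hL1 hmesh hδh.le (hδh.le.trans hh2.le) hC hε.le hUIE' hVan'
  rw [scale_identity hδ0 hh0.le] at main
  refine main.trans (mul_le_mul_of_nonneg_right ?_ (Real.rpow_nonneg hδ0.le _))
  calc 480 * C * (4 * h) ^ ((2:ℝ) / 3) + 50 * (η / 100) ≤ 480 * C * (η / (960 * C)) + 50 * (η / 100) := by gcongr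
    _ = η := by field_simp; ring

end Summit.CriticalPhenomena.CardyFormulaZ2.Theorems.ParafermionFamiliesToSLESix.StripAnchored

end
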